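import Summits.HodgeConjecture.CorCM.HypDel.ExtAmbientReceptacle
import HarnessLib

/-!
# τ0-T3 (2/4) — S5 second layer: `ImageStableOfReciprocity` ⇐ leaves Z1/G1/G2 (`imageStable_of_leaves`), and S5 IS A THEOREM (`imageStableOfReciprocity_holds`)

Cell `hodgecm-mathlib`, crux `HDel` (stmt-HodgeConjecture-24835), fan B / B-plan2 (T3 pen), KEY `t3-tau0-ext-receptacle-port` (B-p19 g5).
τ0-T3 RELOCATES, VERBATIM, the vocabulary and the kernel-checked reductions of the planning workfile
`Summits/HodgeConjecture/HodgeConjecture/Cruxes/HDel/Lines/F1ExtHodgeType.lean` v3b (sha16 2a4912bcb51bc6f9; B-plan2 g2–g4) into IMPORTABLE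
Summits modules (namespace `Summit.HodgeConjecture.CorCM.HypDel.ExtReceptacle`; split in four files by the gate's 400-line rule, workfile order kept:
`ExtAmbientReceptacle` §1–§2 · `ExtAmbientReceptacleImageStable` §3 · `ExtAmbientReceptacleLevelForm` §3b first half ·
`ExtAmbientReceptacleHDel` §3b second half + head + §5 + §7), so that v4's stubs, their leaf closers and the final by-name `HDel` closer can
`import` these names (a Cruxes workfile is not importable by Theorems files — the τ0 / T4 lesson, ★ p633409).  Statements, binders and proofs
are byte-identical to v3b; relocation edits only (the workfile's one open stub, its consumer and the skeleton head are NOT carried; the six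
closed `stub_*` theorems are renamed `*_holds`; the v2 census §6 is dropped).  NOTHING NEW IS ASSERTED; 0 `sorry`.
STATEMENT CONVENTIONS (unchanged): every binder block is the binder block of `Aux.canonicalModel_exists_ext_printed` VERBATIM (B-typ04 ★ p608274),
and `ReciprocityThrough` is the body of `Aux.IsCanonicalDescentAtExt` VERBATIM with the form `(N.obj K, e.inv.app K)` replaced by a receptacle
`(A, ι)`; no new Literature notion, no instance, no notation.

THIS FILE (2/4): §3 (workfile :260–:405) — `LeafZ1`/`LeafG1`/`LeafG2`, their by-name closers `leafZ1_holds` (★ p624611), `leafG1_holds` (★ p625425),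
`leafG2_holds` (★ p625412), the composition `imageStable_of_leaves`; then `imageStableOfReciprocity_holds` (workfile :812–:813, renamed).
HC_CM is proved only modulo the 7 printed citations until rung 0 closes; nothing in this file is a proof of I-1′ or of `HDel`.
[cite: Deligne1971TravauxShimura, Cor. 5.7 p. 156, Exemple 5.8 and Variante 5.9 p. 157, Prop. 1.15 p. 132, 5.2 p. 155, Thm. 4.21 p. 152]
[cite: Deligne1979ShimuraVarieties, Criterion 2.3.1 and 2.2.5 (PDF p. 29), Prop. 2.3.10 (PDF p. 32) of Milne's translation]
[cite: MumfordFogartyKirwan1994, Ch. 7 §3 Thm. 7.9] [cite: Shimura1998, §18.6 Thm. 18.6] [cite: Milne2005ShimuraVarieties, Def. 12.8 (62) p. 114, §13 p. 117, §14 pp. 126–127]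
-/

open Function MulAction Topology NumberField IsDedekindDomain CategoryTheory CategoryTheory.Limits Matrix
  AlgebraicGeometry
open scoped Matrix ComplexOrder
open Literature.AlgebraicGeometry Literature.AlgebraicGeometry.Motives
open Literature.NumberTheory.Automorphic Literature.NumberTheory.Automorphic.UnitaryGroup
open Literature.NumberTheory.Automorphic.Liu2021.AppendixC (C5.OpenCompactSubgroup C5.SmallLevel)
open Literature.Geometry.ComplexHyperbolic Literature.Geometry.ComplexHyperbolic.BallModel
open Literature.NumberTheory.Automorphic.ShimuraDissection
open Literature.AlgebraicGeometry.ShimuraVarieties Literature.AlgebraicGeometry.ShimuraVarieties.UnitaryCanonicalModel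
open Literature.AlgebraicGeometry.ShimuraVarieties.UnitaryCanonicalModel.Aux
open Literature.NumberTheory.ComplexMultiplication (traceField reflexNormFiniteIdele)
open Literature.NumberTheory.AdelicBaseChange (finiteIdeleRelNorm)

namespace Summit.HodgeConjecture.CorCM.HypDel.ExtReceptacle

/-! ### §3. S5 SECOND LAYER (v2): `ImageStableOfReciprocity` ⇐ three NAMED GENERIC LEAVES — the composition is a REAL proof

Deligne's density argument ([Deligne 1971] 5.2 p. 155, proof of Cor. 5.7 p. 156; [Milne 2005] §13 p. 117) for the image
`C := ι(∐_{Cl} Sc.Mc_K) ⊆ A ⊗_E ℂ`, run over EXISTING declarations.  By decl name (★ = in tree, LEAF = named stub below):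
(1) reciprocity at the SPECIAL PAIRS `(p, a)` through ONE line point `x₀` — ★ `UnitaryGroup.cmConjRingHom_apply_eq_of_formCongr_eq_J`,
    ★ `exists_mem_negCone_embedding`, ★ `exists_unique_isLinePoint`, ★ `HeckeQuotientExt.exists_finiteIdele_isArtinCorrespondent_of_forall_mem`,
    ★ `hermForm_self_ne_zero_of_mem_negCone`, ★ `exists_isDiagTwist_recipFactor`, ★ `reflexNormFiniteIdele_mem_torusFinAdelic_of_le`, then the
    receptacle's own field `R.reciprocity`;
(2) the underlying continuous maps: the closed immersion `ιb = ⇑R.ι.left` (closed range: Mathlib `IsClosedImmersion.isClosedEmbedding`) and the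
    Galois HOMEOMORPHISM `g = ⇑(GaloisDescent.gal ℂ R.A σ)` of `A ⊗_E ℂ` (★ `Motives/JacobianGaloisDescent`); LEAF (G1) says `g` computes `σ • ·` on
    underlying points: `(pointsOfForm A (σ • P')).pt = g ((pointsOfForm A P').pt)`;
(3) the special pairs are DENSE in `(∐ Sc.Mc_K)(ℂ)` (LEAF (G2): ★ `Deligne1971.denseRange_mk` per summand through ★ `Sc.pts K` and ★
    `Motives.exists_sigmaHomeomorph_of_isColimit_cofan`), hence their underlying points are ZARISKI dense (LEAF (Z1), now ★ p624611
    `Motives.dense_image_pt_of_dense`; `∐ Sc.Mc_K` is locally of finite type because smooth of relative dimension 2: ★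
    `Motives.smoothOfRelativeDimension_of_isColimit_cofan` + `Sc.smooth K` + Mathlib instances);
(4) `g(C) ⊆ C`: on the dense part `ιb(pt(special))` by (1)+(G1), then by continuity of `g` and closedness of `C` (pure topology);
(5) the translated point `q := pointsOfForm A (σ • ῑ P)` has `q.pt = g (ιb P.pt) ∈ C`, so it LIFTS through the closed immersion — ★
    `AlgPoints.liftClosed` / `AlgPoints.map_liftClosed` (`Motives/HypersurfaceFieldPoints`; `Spec ℂ` reduced) — giving `Q` with `σ • ῑ P = ῑ Q`.
NOT needed (v. A-p05's census READFIRST-I1prime-S5S3-infrastructure 2ca28a2f §3): (Z2) factorisation of a morphism through a closed immersion on a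
dense set (pointwise `liftClosed` suffices; (Z2) is banked ★ p624829 `Morphisms/ClosedImmersionFactorOfDense` for the S3 day) and (LPD) density
of the line points in the ball (ONE line point and its dense Hecke orbit suffice).
[cite: Deligne1971TravauxShimura, 5.2 p. 155, Cor. 5.7 p. 156] [cite: Milne2005ShimuraVarieties, §13 p. 117, Thm. 13.7 p. 120] -/

section S5SecondLayer

/-- **LEAF (Z1) — complex-dense ⟹ Zariski-dense.**  For `X` locally of finite type over `ℂ` and `S ⊆ X(ℂ)` dense in the complex (strong)
topology, the underlying scheme points of `S` are dense in `|X|` (closed points are very dense in a Jacobson space + `X(ℂ) → |X|` continuous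
with image the closed points).  ★ IN TREE since p624611 (A-p05 g4): `Literature.AlgebraicGeometry.Motives.dense_image_pt_of_dense` — the stub
below is closed BY NAME.  [cite: MumfordRedBook1999, I §10 p. 58] [cite: Hartshorne1977, II Ex. 2.7, II Ex. 3.14] -/
def LeafZ1 : Prop :=
  ∀ (X : SchemeOver ℂ) [LocallyOfFiniteType X.hom] (S : Set (ComplexPoints X)),
    Dense S → Dense (AlgPoints.pt '' S : Set X.left)

/-- **LEAF (G1) — `Aut(ℂ/τL)` acts on the underlying space of `X ⊗_L ℂ` through `GaloisDescent.gal`.**  For an `L`-scheme `X`, `τ : L →+* ℂ`,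
`σ ∈ Aut(ℂ/τL)` and `P ∈ X(ℂ)`: the underlying point of the base-changed point of `σ • P` is `gal σ` applied to that of `P` (one line from ★
`UnitaryCanonicalModel.lift_comp_gal` + ★ `lift_eq_baseChangeEquiv_left`, `.base` at the closed point of `Spec ℂ`).  ★ IN TREE since p625425
(A-p18 g4): `Literature.AlgebraicGeometry.Motives.pt_baseChangeEquiv_smul τ X σ P` (`Motives/ComplexPointsGaloisUnderlying`) — this signature
VERBATIM; the stub below is closed (in-file twin proof in v2, by-name alias from v3 on).  [cite: Milne2005ShimuraVarieties, §13 p. 117] [cite: Deligne1971TravauxShimura, 5.2 p. 155] -/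
def LeafG1 : Prop :=
  ∀ (L : Type) [Field L] (τ : L →+* ℂ) (X : SchemeOver L)
    (σ : letI : Algebra L ℂ := τ.toAlgebra; ℂ ≃ₐ[L] ℂ) (P : letI : Algebra L ℂ := τ.toAlgebra; ComplexPoints X),
    letI : Algebra L ℂ := τ.toAlgebra
    (AlgPoints.baseChangeEquiv τ X (σ • P)).pt = (GaloisDescent.gal ℂ X σ).base ((AlgPoints.baseChangeEquiv τ X P).pt)

/-- **LEAF (G2) — the diagonal special pairs are dense in `(∐_{Cl} Sc.Mc_K)(ℂ)`.**  For every `x ∈ 𝔹²` the map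
`(p, a) ↦ summandPointExt M Sc L₀ K p x a` has dense range: per summand this is ★ `Deligne1971.denseRange_mk` (density of the Hecke orbit of ONE
point of the ball in `Sh_K`, real approximation) read through the record's homeomorphism ★ `Sc.pts K`, and the summands are assembled by ★
`Motives.exists_sigmaHomeomorph_of_isColimit_cofan`.  `H` is hermitian from the frame `hT` (★ `cmConjRingHom_apply_eq_of_formCongr_eq_J`,
★ `transpose_map_complexConj_eq`), so no hermitian binder.  ★ IN TREE since p625412 (A-p06 g4):
`Literature.AlgebraicGeometry.ShimuraVarieties.UnitaryCanonicalModel.Aux.denseRange_summandPointExt M Sc L₀ K x` (`ShimuraVarieties/UnitaryAuxiliarySpecialPairsDense`)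
— this signature VERBATIM; the stub below is closed BY NAME.  [cite: Deligne1971TravauxShimura, 5.2 p. 155, Prop. 1.15 p. 132] -/
def LeafG2 : Prop :=
  ∀ (L : Type) [Field L] [NumberField L] [IsCMField L] (H : Matrix (Fin 3) (Fin 3) L) (τ : L →+* ℂ)
    (T : GL (Fin 3) ℂ) (hT : formCongr (starRingEnd ℂ) T (H.map τ) = BallModel.J)
    (K₀ : C5.OpenCompactSubgroup ↥(finAdelic (↥(maximalRealSubfield L)) L (IsCMField.complexConj L) 3 H))
    (M : Type) [Field M] [NumberField M] [IsCMField M] (Sc : ComplexRecordSystem L H τ T hT K₀)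
    (L₀ : C5.OpenCompactSubgroup ↥(torusFinAdelic M)) (K : C5.SmallLevel K₀) (x : Ball),
    DenseRange (fun pa : classGroup M L₀ × finAdelic (↥(maximalRealSubfield L)) L (IsCMField.complexConj L) 3 H =>
      summandPointExt M Sc L₀ K pa.1 x pa.2)

/-- **(Z1) closed BY NAME** — ★ p624611 `Motives.dense_image_pt_of_dense` (A-p05 g4).  Not a `sorry`. -/
theorem leafZ1_holds : LeafZ1 := fun _ _ _ hS => dense_image_pt_of_dense hS

/-- **(G1) closed** — the tree theorem of record is ★ p625425 `Motives.pt_baseChangeEquiv_smul` (A-p18 g4,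
`Motives/ComplexPointsGaloisUnderlying`, this statement token for token); below, its ten-line in-file twin over ★ `lift_comp_gal` +
★ `lift_eq_baseChangeEquiv_left` (`.base` at the closed point of `Spec ℂ`), so that this file elaborates on every farm node today.
Not a `sorry`.  [cite: Milne2005ShimuraVarieties, §13 p. 117] -/
theorem leafG1_holds : LeafG1 :=
  -- ★ p625425 `Motives.pt_baseChangeEquiv_smul` (A-p18 g5) BY NAME (v2 carried an in-file twin while its olean was unservable)
  fun _ _ τ X σ P => pt_baseChangeEquiv_smul τ X σ P

/-- **(G2) closed BY NAME** — ★ p625412 `UnitaryCanonicalModel.Aux.denseRange_summandPointExt` (A-p06 g4, `ShimuraVarieties/UnitaryAuxiliarySpecialPairsDense`).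
Not a `sorry`.  [cite: Deligne1971TravauxShimura, 5.2 p. 155] -/
theorem leafG2_holds : LeafG2 := fun _ _ _ _ _ _ _ _ _ M _ _ _ Sc L₀ K x => denseRange_summandPointExt M Sc L₀ K x

/-- **S5 COMPOSITION (kernel-checked, no `sorry` of its own): `LeafZ1 → LeafG1 → LeafG2 → ImageStableOfReciprocity`** — steps (1)–(5) of the
section docstring.  The receptacle enters only through its four fields (`R.A`, `R.ι`, `R.isClosedImmersion`, `R.reciprocity`), so the day
S1+S2+S4 produce an `AmbientReceptacle` this proof is the S5 proof verbatim.  [cite: Deligne1971TravauxShimura, 5.2 p. 155, Cor. 5.7 p. 156]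
[cite: Milne2005ShimuraVarieties, §13 p. 117] -/
theorem imageStable_of_leaves (hZ1 : LeafZ1) (hG1 : LeafG1) (hG2 : LeafG2) : ImageStableOfReciprocity := by
  intro L _ _ _ H τ T hT hpos hanis K₀ htf Sc M _ _ _ j Φ hΦ E _ hE hΦE L₀ K R σ P
  haveI : NumberField ↥E := NumberField.mk
  letI : Algebra L ↥E := (toFieldOfMem τ E hE).toAlgebra
  haveI : IsClosedImmersion R.ι.left := R.isClosedImmersion
  -- (1) RECIPROCITY AT THE SPECIAL PAIRS THROUGH ONE LINE POINT `x₀` (existence trio + diagonal twist + torus membership, all tree ★)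
  have hH : ∀ i j, cmConjRingHom L (H i j) = H j i := cmConjRingHom_apply_eq_of_formCongr_eq_J L H τ T hT
  obtain ⟨v₃, hv⟩ := exists_mem_negCone_embedding hT
  obtain ⟨x₀, hx₀, -⟩ := exists_unique_isLinePoint L H τ T hT v₃ hv
  obtain ⟨s, hs⟩ :=
    HeckeQuotientExt.exists_finiteIdele_isArtinCorrespondent_of_forall_mem τ E hE σ.toRingEquiv fun y => σ.commutes y
  have hv' : ShimuraVarieties.hermForm (cmConjRingHom L) H v₃ v₃ ≠ 0 := hermForm_self_ne_zero_of_mem_negCone hv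
  obtain ⟨d, hd⟩ := exists_isDiagTwist_recipFactor H v₃ hH hv' (finiteIdeleRelNorm L ↥E s)
  let t : ↥(torusFinAdelic M) :=
    ⟨reflexNormFiniteIdele M Φ E s, reflexNormFiniteIdele_mem_torusFinAdelic_of_le M Φ E hΦE s⟩
  have hrec : ∀ (a : finAdelic (↥(maximalRealSubfield L)) L (IsCMField.complexConj L) 3 H) (p : classGroup M L₀),
      σ • (pointsOfForm R.A).symm (AlgPoints.map R.ι (summandPointExt M Sc L₀ K p x₀ a)) =
        (pointsOfForm R.A).symm (AlgPoints.map R.ι (summandPointExt M Sc L₀ K (classOf M L₀ t * p) x₀ (d * a))) :=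
    fun a p => R.reciprocity σ s hs v₃ x₀ hx₀ d hd t rfl a p
  -- (2) THE UNDERLYING MAPS: the closed immersion `ιb` and the Galois homeomorphism `g = gal σ` of `A ⊗_E ℂ`; (G1) read through `pointsOfForm`
  let Y : SchemeOver ℂ := (complexSystemExt M Sc L₀).obj K
  let g : ↥(GaloisDescent.bc ℂ R.A) → ↥(GaloisDescent.bc ℂ R.A) := fun y => GaloisDescent.gal ℂ R.A σ y
  have hg : Continuous g := (GaloisDescent.gal ℂ R.A σ).continuous
  let ιb : ↥Y.left → ↥(GaloisDescent.bc ℂ R.A) := fun y => R.ι.left y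
  have hιb : Continuous ιb := R.ι.left.continuous
  have hC : IsClosed (Set.range ιb) := R.ι.left.isClosedEmbedding.isClosed_range
  have hgal : ∀ P' : ComplexPoints R.A, (pointsOfForm R.A (σ • P')).pt = g ((pointsOfForm R.A P').pt) :=
    fun P' => hG1 (↥E) (algebraMap ↥E ℂ) R.A σ P'
  -- (3) THE SPECIAL SET IS DENSE (G2), HENCE ZARISKI DENSE ON UNDERLYING POINTS (Z1; `Y` is smooth of rel. dim. 2, hence lft)
  let Sp : Set (ComplexPoints Y) :=
    Set.range fun pa : classGroup M L₀ × finAdelic (↥(maximalRealSubfield L)) L (IsCMField.complexConj L) 3 H =>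
      summandPointExt M Sc L₀ K pa.1 x₀ pa.2
  have hSp : Dense Sp := hG2 L H τ T hT K₀ M Sc L₀ K x₀
  haveI : SmoothOfRelativeDimension 2 Y.hom :=
    smoothOfRelativeDimension_of_isColimit_cofan (coproductIsCoproduct fun _ : classGroup M L₀ => Sc.Mc.obj K)
      fun _ => Sc.smooth K
  haveI : Smooth Y.hom := SmoothOfRelativeDimension.smooth 2 _
  have hZ : Dense (AlgPoints.pt '' Sp : Set ↥Y.left) := hZ1 Y Sp hSp
  -- (4) `g` MAPS `C = range ιb` INTO ITSELF: on the Zariski-dense part `ιb '' (pt '' Sp)` by (1)+(G1), then by continuity and closedness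
  have h1 : Set.range ιb ⊆ closure (ιb '' (AlgPoints.pt '' Sp)) := by
    rintro _ ⟨y, rfl⟩
    have hy : y ∈ closure (AlgPoints.pt '' Sp) := by
      rw [hZ.closure_eq]
      exact Set.mem_univ y
    exact image_closure_subset_closure_image hιb ⟨y, hy, rfl⟩
  have h2 : g '' (ιb '' (AlgPoints.pt '' Sp)) ⊆ Set.range ιb := by
    rintro _ ⟨_, ⟨_, ⟨P₀, ⟨⟨p, a⟩, rfl⟩, rfl⟩, rfl⟩, rfl⟩
    refine ⟨AlgPoints.pt (summandPointExt M Sc L₀ K (classOf M L₀ t * p) x₀ (d * a)), ?_⟩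
    have e1 := hgal ((pointsOfForm R.A).symm (AlgPoints.map R.ι (summandPointExt M Sc L₀ K p x₀ a)))
    rw [hrec a p, Equiv.apply_symm_apply, Equiv.apply_symm_apply] at e1
    exact e1
  have h3 : g '' Set.range ιb ⊆ Set.range ιb := by
    refine (Set.image_mono h1).trans ?_
    exact (image_closure_subset_closure_image hg).trans ((closure_mono h2).trans hC.closure_eq.subset)
  -- (5) LIFT THE TRANSLATED POINT THROUGH THE CLOSED IMMERSION (`AlgPoints.liftClosed`; `Spec ℂ` is reduced)
  set q : ComplexPoints ((Motives.baseChange ↥E ℂ).obj R.A) :=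
    pointsOfForm R.A (σ • (pointsOfForm R.A).symm (AlgPoints.map R.ι P)) with hq_def
  have hq : q.pt ∈ Set.range R.ι.left := by
    have e2 := hgal ((pointsOfForm R.A).symm (AlgPoints.map R.ι P))
    rw [Equiv.apply_symm_apply] at e2
    have : q.pt = g (ιb P.pt) := e2
    rw [this]
    exact h3 ⟨ιb P.pt, ⟨P.pt, rfl⟩, rfl⟩
  refine ⟨q.liftClosed R.ι hq, ?_⟩
  rw [AlgPoints.map_liftClosed, hq_def, Equiv.symm_apply_apply]

end S5SecondLayer

/-- **S5 — `ImageStableOfReciprocity` IS A THEOREM** (v1: a `sorry`; v2: Deligne's density argument [Deligne 1971] 5.2 run in §3 as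
`imageStable_of_leaves` over the three ★ leaves).  No `sorry` below it; kept under its v1 name so the head is unchanged.
[cite: Deligne1971TravauxShimura, 5.2 p. 155, Cor. 5.7 p. 156] -/
theorem imageStableOfReciprocity_holds : ImageStableOfReciprocity :=
  imageStable_of_leaves leafZ1_holds leafG1_holds leafG2_holds

end Summit.HodgeConjecture.CorCM.HypDel.ExtReceptacle
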